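import Mathlib
import HarnessLib
import Literature.NumberTheory.Sieve.LinearEquationsInPrimes

/-!
# Route `ScaleTauberianCarving` — definitions (pattern-local vocabulary of decomp-parity node G1.2.T)

Readable vocabulary for the glue / exactness files of route-Parity-ScaleTauberianCarving (rev 0, commit
71d4b4a7eaf4; decomp-parity lens-6 g6 node «ScaleTauberianCarving», critic CLEARED HOME/STATUS.md l.316,
CRITIC-LEDGER row 63).  The BORN items `LogWindowHL` (stmt-Parity-31399), `ScaleRigidity` (31400), `UpperGlue`
(31401), `LowerGlue` (31402) inline this vocabulary textually (the gate files fully-qualified texts); the objects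
below are the abbreviations the cell kernel `HOME/decomp-parity-lens-6/g6/ScaleTauberianCarving.lean` (@32d8c3ef)
works with: the signed Green–Tao error `err`, the dilation `dil` of a convex body from scale `N` to scale `n`, and
the PATTERN-LOCAL statements `FixedAt` (two-sided fixed-pattern Hardy–Littlewood for one system), `LogWindowHLAt`
(piece A at one system), `ScaleRigidityAt` (piece B at one system, R-form), `ScaleCauchyAt` (the stronger
uniform-Cauchy spelling, not an item), and the global `Fixed`.  Definitions only; no statements.  This module does
not import the route file (it needs only the Green–Tao vocabulary of `Literature.NumberTheory.Sieve.LinearEquationsInPrimes`).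
-/

namespace Summit.Parity.GeneralizedHardyLittlewood.ScaleTauberianCarving

open scoped BigOperators
open Finset Literature.NumberTheory.Sieve

variable {d t : ℕ}

/-- The signed Green–Tao error of the system `Ψ` on the body `K` at scale `n`:
`∑_{x ∈ K ∩ ℤ^d} ∏ Λ(ψᵢ(x)) − β_∞(Ψ,K)·𝔖(Ψ)`. (Green–Tao 2010, Conj. 1.2). -/
noncomputable def err (Ψ : Fin t → AffLinForm d) (K : Set (Fin d → ℝ)) (n : ℕ) : ℝ :=
  vonMangoldtSum Ψ K n - archFactor Ψ K * singularProduct Ψ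

/-- The body `K ⊆ [-N,N]^d` transported to scale `n`: the dilate `(n/N) • K ⊆ [-n,n]^d`, spelled as an
image (exactly as the born route items spell it) so that no `Pointwise` scope is needed. (Folklore.) -/
def dil (N n : ℕ) (K : Set (Fin d → ℝ)) : Set (Fin d → ℝ) :=
  (fun x : Fin d → ℝ => ((n : ℝ) / (N : ℝ)) • x) '' K

/-- The two-sided fixed-pattern Hardy–Littlewood statement for ONE system `Ψ` (= `FixedUpper ∧ FixedLower`
restricted to `Ψ`): for every `ε > 0`, eventually in `N`, uniformly over convex `K ⊆ [-N,N]^d`,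
`|err Ψ K N| ≤ ε N^d`. (Green–Tao 2010, Conj. 1.2). -/
def FixedAt (Ψ : Fin t → AffLinForm d) : Prop :=
  ∀ ε : ℝ, 0 < ε → ∃ N₀ : ℕ, ∀ N : ℕ, N₀ ≤ N → ∀ K : Set (Fin d → ℝ), Convex ℝ K →
    K ⊆ realBox d N → |err Ψ K N| ≤ ε * (N : ℝ) ^ d

/-- Piece A, pattern-local: **log-window Hardy–Littlewood** for `Ψ`. For every `ε > 0`, eventually in the
base scale `N`, for every scale window `(N, M]` with `M ≥ N²` and every convex `K ⊆ [-N,N]^d`, the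
logarithmically weighted mean of the normalised signed errors of `Ψ` on the dilates `(n/N)•K`, `n ∈ (N,M]`,
is at most `ε`: `|∑_{N<n≤M} (err Ψ ((n/N)•K) n / n^d)/n| ≤ ε ∑_{N<n≤M} 1/n`. For bounded error sequences
this is the classical `o(log)` logarithmic average restricted to windows of logarithmic length `≥ log N`.
(Shape: Tao 2016 FMP Thm 1.2; Tao–Teräväinen 2019, §1.) -/
def LogWindowHLAt (Ψ : Fin t → AffLinForm d) : Prop :=
  ∀ ε : ℝ, 0 < ε → ∃ N₀ : ℕ, ∀ N : ℕ, N₀ ≤ N → ∀ M : ℕ, N ^ 2 ≤ M →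
    ∀ K : Set (Fin d → ℝ), Convex ℝ K → K ⊆ realBox d N →
      |∑ n ∈ Ioc N M, err Ψ (dil N n K) n / (n : ℝ) ^ d / n| ≤ ε * ∑ n ∈ Ioc N M, (1 : ℝ) / n

/-- Piece B, pattern-local: **two-scale rigidity on the matched window** for `Ψ` (the R-form; critic P4
economy). For every `ε > 0`, eventually in `N`, for every `n` with `N ≤ n ≤ N²` and every convex
`K ⊆ [-N,N]^d`, `|err Ψ K N / N^d − err Ψ ((n/N)•K) n / n^d| ≤ ε`: the normalised error is ε-rigid along every
dilation chain across the scale window `[N, N²]` — the SAME window piece A averages over. This is strictly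
weaker (model grade: ultra-slowly drifting worlds `err/N^d ≈ sin √(log log N)` satisfy it without converging)
than the uniform-Cauchy spelling «the limit exists» (`ScaleCauchyAt`, kept below for the record), and is the
weakest partner of A for which the exchange stays kernel-elementary: `fixedAt_of_pieces` only ever evaluates B
at `n ∈ (N, N²]`. (Tao–Teräväinen 2019, §1, p. 5 fn. 3; Bombieri 1976.) -/
def ScaleRigidityAt (Ψ : Fin t → AffLinForm d) : Prop :=
  ∀ ε : ℝ, 0 < ε → ∃ N₀ : ℕ, ∀ N : ℕ, N₀ ≤ N → ∀ n : ℕ, N ≤ n → n ≤ N ^ 2 →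
    ∀ K : Set (Fin d → ℝ), Convex ℝ K → K ⊆ realBox d N →
      |err Ψ K N / (N : ℝ) ^ d - err Ψ (dil N n K) n / (n : ℝ) ^ d| ≤ ε

/-- The stronger uniform-Cauchy spelling «the density EXISTS» (all `n ≥ N`; X6's (R) strengthened): kept only to
record the exchange rate — it implies the matched-window R-form trivially and is implied by the leaf, so it is
equivalent to `ScaleRigidityAt` modulo piece A (`scaleCauchyAt_of_fixedAt`, `fixedAt_iff`). Not a route item.
(Tao–Teräväinen 2019, §1, p. 5 fn. 3.) -/
def ScaleCauchyAt (Ψ : Fin t → AffLinForm d) : Prop :=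
  ∀ ε : ℝ, 0 < ε → ∃ N₀ : ℕ, ∀ N : ℕ, N₀ ≤ N → ∀ n : ℕ, N ≤ n →
    ∀ K : Set (Fin d → ℝ), Convex ℝ K → K ⊆ realBox d N →
      |err Ψ K N / (N : ℝ) ^ d - err Ψ (dil N n K) n / (n : ℝ) ^ d| ≤ ε

/-- `Fixed` = the two-sided fixed-pattern Hardy–Littlewood statement for ALL `d, t ≥ 1` and all
non-degenerate systems (= the record's `FixedUpper ∧ FixedLower`, proved in the exactness file).
(Green–Tao 2010, Conj. 1.2). -/
def Fixed : Prop :=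
  ∀ (d t : ℕ), 1 ≤ d → 1 ≤ t → ∀ Ψ : Fin t → AffLinForm d, IsNondegenerateSystem Ψ → FixedAt Ψ

end Summit.Parity.GeneralizedHardyLittlewood.ScaleTauberianCarving
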